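import Summits.QuantumFields.YangMills.Theorems.SwapTwistDeficitTwistedRingInsertion
import Summits.QuantumFields.YangMills.Theorems.SwapTwistDeficitTwistedRingFarBonds
import Summits.QuantumFields.YangMills.Theorems.SwapTwistDeficitWeakSmallBallDoor
import Summits.QuantumFields.YangMills.Theorems.ToronSmallBallAssembly
import Summits.QuantumFields.YangMills.Theorems.ToronSmallBallToronCoreRaritySubQuartic
import Summits.QuantumFields.YangMills.Theorems.ToronSmallBallOffCoreStripWindow
import HarnessLib

/-!
# ★ THE TWIST-RATIO WINDOW: `Z^S_phys(2L) ≤ β^{−a}·Z_phys(2L)` on a Laplace window `L₀ ≤ L ≤ β^a`, and O1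
# (`SwapTwistDeficit.TwistRatioVanishesFixedL`, item stmt-QuantumFields-23802) for every `L ≥ L₀`

Seat ym-line-fcl-p3 g42 (free hands), for LINE g11-A of seat ym-idea-4.  The swap-twisted zero-flux partition function
`Z^S = TT.twistTrace L β (2L) = Tr_phys(S (PK_β)^{2L})` of Wilson's `SU(2)` theory on the `2L × L³` torus, glued in time through the exchange `S` of
the spatial axes `0, 1` ('t Hooft's twisted box), is POLYNOMIALLY SUPPRESSED against the periodic one `Z = TT.physTrace L β (2L)`, uniformly on a
window — the twist free energy `−log(Z^S/Z) ≥ a·log β`: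

* §1 `twistRatio_window_of_smallBall` — DOOR: for `0 < a ≤ 1`, `γ < 1/2 − 4a`, the thermal small-ball estimate
  (SB) `insTrace L β 𝟙{|polDist − polDist∘S| ≤ β^{−γ}} 0 ≤ β^{−a}·Z` on `L₀ ≤ L ≤ β^a` gives `Z^S ≤ 2β^{−a}·Z` there.  Proof: the strip door
  `Z^S ≤ Z^S_strip + far cost` (`…TwistedRingFarBonds`, strip width `2L·(L t)`, `βt²/2 = (a + 2L·N + 4) log β`), the operator-positivity step
  `Z^S_strip ≤ Z_strip = insTrace 𝟙_strip 0` (`…TwistedRingInsertion`), the width bound `2L(Lt) ≤ β^{−γ}` (`TT.stripWidth_antipodal_le_rpow`)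
  and the far cost `β^{−a−4}·(e^{2β|E|}β^{−N})^{2L} ≤ β^{−a}Z/8` against the explicit floor (`…SmallBallFloors`);
* §2 `smallBall_window_of_landed` — (SB) HOLDS, with constant one, from the LANDED cruxes `ToronSmallBall.ToronCoreRaritySubQuartic` ⟨23956⟩ and
  `OffCoreStripWindowDeep` ⟨23957⟩ (union bound `STRIP ⊆ CORE ∪ (STRIP ∩ OFF-CORE)`, verbatim the bookkeeping of `ToronSmallBall.assemblyDeep_proof`);
* §3 ★★ `twistRatio_window` — `∃ a > 0, β₀, L₀: ∀ β ≥ β₀, L₀ ≤ L ≤ β^a, 0 ≤ Z^S_phys(2L) ≤ β^{−a}·Z_phys(2L)`.  Strictly stronger than the landed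
  window deficit `TwistDeficitLaplaceWindow` ⟨23776⟩ (`Z − Z^S ≥ β^{−k}Z`): here `Z − Z^S ≥ (1 − β^{−a})Z`;
* §4 ★ `twistRatio_tendsto_zero_eventually` — O1 EVENTUALLY IN `L`: `∃ L₀, ∀ L ≥ L₀, Z^S_phys(2L)/Z_phys(2L) → 0` as `β → ∞` — the statement of
  `SwapTwistDeficit.TwistRatioVanishesFixedL` (stmt-QuantumFields-23802) for every `L` above the (existential) window threshold of the two cruxes;
  the item asks it for every `L ≥ 2`, which this file does NOT give (the thresholds `L₀` of ⟨23956⟩/⟨23957⟩ are not exposed by their statements).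

HONEST FRAMING: fixed-lattice ∕ Laplace-window transfer-matrix statements for a support item of a DRAFT line onto the RECORD rung K2a (R2ξ″); the
polynomial tail, `SubFemtoEntropy`, infinite volume, the continuum limit and the Clay Yang–Mills gap are untouched — the YM mass gap is NOT proved.
No `sorry`, no new axiom, no new definition.  References: [cite: tHooft1979Flux] (twisted boxes, electric-flux free energies); [cite: TomboulisYaffe1985]
(bounds on twisted partition functions); [cite: Luscher1983, §2] (torons, zero-flux projection); [cite: MontvayMunster1994, (3.145)];
[cite: SeilerLNP1982, §3]; [cite: ReedSimonI1980, Thm. VI.23].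
-/

set_option autoImplicit false

noncomputable section

open MeasureTheory Filter Topology Real Function
open scoped Matrix ComplexConjugate BigOperators
open Literature.MathematicalPhysics.QuantumLattice
open Literature.MathematicalPhysics.QuantumFieldTheory hiding SU2
open Summit.QuantumFields.YangMills.Theorems

namespace Summit.QuantumFields.YangMills.Theorems.SwapTwistDeficit

open Summit.QuantumFields.YangMills.Theorems.FemtoTransferGap
open Summit.QuantumFields.YangMills.Theorems.FemtoTransferGap.FlatSheet

/-! ## §1 DOOR: the twist ratio on the window from the thermal small-ball estimate -/

set_option maxHeartbeats 800000 in
/-- ★ **DOOR — the twist ratio from (SB).**  Let `0 < a ≤ 1`, `γ < 1/2 − 4a`, and suppose (SB): for `β ≥ β₀` and `L₀ ≤ L ≤ β^a` the zero-flux thermal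
weight of the strip `{|polDist − polDist∘S| ≤ β^{−γ}}` is `≤ β^{−a}·Z_phys(2L)`.  Then, for `β ≥ β₀'`, `L₀' ≤ L ≤ β^a`:
`Z^S_phys(2L) ≤ 2β^{−a}·Z_phys(2L)`.  (Strip door + `Z^S_strip ≤ Z_strip` + width + far cost against the floor.)
[cite: tHooft1979Flux] [cite: SeilerLNP1982, §3] [cite: Luscher1983, §2] -/
theorem twistRatio_window_of_smallBall {a γ : ℝ} (ha : 0 < a) (ha1 : a ≤ 1) (hγ : γ < 1 / 2 - 4 * a)
    (hSB : ∃ β₀ : ℝ, ∃ L₀ : ℕ, ∀ β : ℝ, β₀ ≤ β → ∀ (L : ℕ) [NeZero L], L₀ ≤ L → (L : ℝ) ≤ β ^ a →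
      TT.insTrace L β (Set.indicator {U : GaugeConfig 3 L FemtoTransferGap.SU2 |
          |polDist U - polDist (configPerm (Equiv.swap (0 : Fin 3) 1) U)| ≤ β ^ (-γ)} fun _ => (1 : ℝ)) 0 ≤
        β ^ (-a) * TT.physTrace L β (2 * L)) :
    ∃ β₀ : ℝ, ∃ L₀ : ℕ, ∀ β : ℝ, β₀ ≤ β → ∀ (L : ℕ) [NeZero L], L₀ ≤ L → (L : ℝ) ≤ β ^ a →
      TT.twistTrace L β (2 * L) ≤ 2 * β ^ (-a) * TT.physTrace L β (2 * L) := by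
  obtain ⟨β₀, L₀, hSB⟩ := hSB
  obtain ⟨β₁, hβ₁9, hwidth⟩ := TT.stripWidth_antipodal_le_rpow ha1 hγ
  set w₀ : ℝ := Real.exp (-(1 / 2 : ℝ)) * (8 / (3 * π ^ 3)) with hw₀
  refine ⟨max (max β₀ β₁) (4 / w₀), max L₀ 1, fun β hβ L _ hL hLβ => ?_⟩
  have hββ₀ : β₀ ≤ β := ((le_max_left _ _).trans (le_max_left _ _)).trans hβ
  have hββ₁ : β₁ ≤ β := ((le_max_right _ _).trans (le_max_left _ _)).trans hβ
  have hβw : 4 / w₀ ≤ β := (le_max_right _ _).trans hβ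
  have hβ9 : 9 ≤ β := hβ₁9.trans hββ₁
  have hβ1 : 1 ≤ β := by linarith
  have hβ0 : 0 < β := by linarith
  have hL1 : 1 ≤ L := (le_max_right _ _).trans hL
  have hL₀ : L₀ ≤ L := (le_max_left _ _).trans hL
  -- data
  set E : ℕ := Fintype.card (Edge 3 L) with hE
  set P : ℕ := Fintype.card (Plaquette 3 L) with hP
  set N : ℕ := 8 * P + 97 * E with hN
  set M : ℝ := Real.exp (2 * β) ^ E with hM
  set Z : ℝ := TT.physTrace L β (2 * L) with hZ
  set c : ℝ := a + 2 * L * (8 * (P : ℝ) + 97 * (E : ℝ)) + 4 with hc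
  set t : ℝ := Real.sqrt (2 * c * Real.log β / β) with ht
  have hM0 : 0 < M := by positivity
  have hZpos : 0 < Z := TT.physTrace_two_mul_pos hL1 hβ1
  have hlog0 : 0 ≤ Real.log β := Real.log_nonneg hβ1
  have hc0 : 0 ≤ c := by rw [hc]; positivity
  have ht0 : 0 ≤ t := Real.sqrt_nonneg _
  -- the strip door (stated before naming the strip, so that the name is substituted into it)
  have hdoor := TT.twistTrace_le_twistChainStrip_add (L := L) hβ0.le ht0
  -- the strip of the door and its thermal weight
  set A : Set (GaugeConfig 3 L FemtoTransferGap.SU2) :=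
    {U | |polDist U - polDist (configPerm (Equiv.swap (0 : Fin 3) 1) U)| ≤ 2 * (L : ℝ) * ((L : ℝ) * t)} with hA
  have hAm : MeasurableSet A := measurableSet_strip _
  have hAS : ∀ U, configPerm (Equiv.swap (0 : Fin 3) 1) U ∈ A ↔ U ∈ A := fun U => by
    simp only [hA, Set.mem_setOf_eq]
    rw [TT.configPerm_swap_swap, abs_sub_comm]
  have hwid : 2 * (L : ℝ) * ((L : ℝ) * t) ≤ β ^ (-γ) := by
    have h := hwidth β hββ₁ L hLβ
    simpa only [ht, hc] using h
  have hAB : A ⊆ {U | |polDist U - polDist (configPerm (Equiv.swap (0 : Fin 3) 1) U)| ≤ β ^ (-γ)} := fun U hU => le_trans hU hwid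
  have hstrip : TT.insTrace L β (A.indicator fun _ => (1 : ℝ)) 0 ≤ β ^ (-a) * Z :=
    (TT.insTrace_indicator_zero_mono hβ0.le hAm (measurableSet_strip _) hAB).trans (hSB β hββ₀ L hL₀ hLβ)
  -- the twisted ring over the strip weighs at most the periodic one
  have hpos := TT.twistChainIndicator_le_insTrace (L := L) β hAm hAS
  -- the floor `Z ≥ (M β^{-N})^{2L}`
  have hlam : M * (β ^ N)⁻¹ ≤ levelValue su2Rep L β 0 := TT.levelValue_zero_ge_rpow hβ9 hβw
  have hfloor : (M * (β ^ N)⁻¹) ^ (2 * L) ≤ Z :=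
    (pow_le_pow_left₀ (by positivity) hlam _).trans (TT.pow_levelValue_zero_le_physTrace hL1 hβ1)
  -- the far term `e^{β(2E − t²/2)} M^{2L−1} = β^{-c} M^{2L}`, `c = a + 2LN + 4`
  have hβt : β * t ^ 2 / 2 = c * Real.log β := by
    have h2 : t ^ 2 = 2 * c * Real.log β / β := by rw [ht, Real.sq_sqrt (by positivity)]
    rw [h2]
    field_simp
  have eExp : Real.exp (-(β * t ^ 2 / 2)) = β ^ (-c) := by
    rw [hβt, Real.rpow_def_of_pos hβ0]; congr 1; ring
  have eM : Real.exp (β * (2 * (E : ℝ) - t ^ 2 / 2)) = M * Real.exp (-(β * t ^ 2 / 2)) := by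
    rw [hM, ← Real.exp_nat_mul, ← Real.exp_add]; congr 1; ring
  have hη : Real.exp (β * (2 * (E : ℝ) - t ^ 2 / 2)) * M ^ (2 * L - 1) = β ^ (-c) * M ^ (2 * L) := by
    rw [eM, eExp]
    have e2 : M ^ (2 * L) = M * M ^ (2 * L - 1) := by
      rw [← pow_succ']; congr 1; omega
    rw [e2]; ring
  have hNc : β ^ (-c) = β ^ (-a) * ((β ^ N) ^ (2 * L))⁻¹ * β ^ (-(4 : ℝ)) := by
    rw [hc, show -(a + 2 * L * (8 * (P : ℝ) + 97 * (E : ℝ)) + 4) = -a + -(((2 * L * N : ℕ) : ℝ)) + -(4 : ℝ) by rw [hN]; push_cast; ring,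
      Real.rpow_add hβ0, Real.rpow_add hβ0, Real.rpow_neg hβ0.le (((2 * L * N : ℕ) : ℝ)), Real.rpow_natCast, mul_comm (2 * L) N, pow_mul]
  have hβ4 : β ^ (-(4 : ℝ)) ≤ 1 / 8 := by
    rw [Real.rpow_neg hβ0.le, show (4 : ℝ) = ((4 : ℕ) : ℝ) by norm_num, Real.rpow_natCast, inv_eq_one_div]
    have h8 : (8 : ℝ) ≤ β ^ 4 := by
      have h2 : (2 : ℝ) ≤ β := by linarith
      calc (8 : ℝ) ≤ 2 ^ 4 := by norm_num
        _ ≤ β ^ 4 := pow_le_pow_left₀ (by norm_num) h2 4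
    exact div_le_div_of_nonneg_left zero_le_one (by norm_num) h8
  have hfar : Real.exp (β * (2 * (E : ℝ) - t ^ 2 / 2)) * M ^ (2 * L - 1) ≤ β ^ (-a) / 8 * Z := by
    rw [hη, hNc]
    have hpos1 : 0 ≤ β ^ (-a) := Real.rpow_nonneg hβ0.le _
    have hkey : ((β ^ N) ^ (2 * L))⁻¹ * M ^ (2 * L) ≤ Z := by
      rw [← inv_pow, ← mul_pow, mul_comm]; exact hfloor
    calc β ^ (-a) * ((β ^ N) ^ (2 * L))⁻¹ * β ^ (-(4 : ℝ)) * M ^ (2 * L)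
        = β ^ (-a) * β ^ (-(4 : ℝ)) * (((β ^ N) ^ (2 * L))⁻¹ * M ^ (2 * L)) := by ring
      _ ≤ β ^ (-a) * (1 / 8) * Z := mul_le_mul (mul_le_mul_of_nonneg_left hβ4 hpos1) hkey (by positivity) (by positivity)
      _ = β ^ (-a) / 8 * Z := by ring
  -- combine
  have hZS : TT.twistTrace L β (2 * L) ≤ β ^ (-a) * Z + β ^ (-a) / 8 * Z := by
    linarith [hdoor, hpos, hstrip, hfar]
  have hpos2 : 0 ≤ β ^ (-a) * Z := mul_nonneg (Real.rpow_nonneg hβ0.le _) hZpos.le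
  calc TT.twistTrace L β (2 * L) ≤ β ^ (-a) * Z + β ^ (-a) / 8 * Z := hZS
    _ ≤ 2 * β ^ (-a) * Z := by nlinarith [hpos2]

/-! ## §2 The thermal small-ball estimate from the landed toron-core cruxes -/

set_option maxHeartbeats 800000 in
/-- **(SB) holds on a window**, with constant one: there are `0 < a ≤ 1` and `γ < 1/2 − 4a` such that eventually in `β`, for `L₀ ≤ L ≤ β^a`,
`insTrace L β 𝟙{|polDist − polDist∘S| ≤ β^{−γ}} 0 ≤ β^{−a}·Z_phys(2L)`.  From the LANDED `ToronSmallBall.toronCoreRaritySubQuartic_proof` ⟨23956⟩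
and `ToronSmallBall.offCoreStripWindowDeep_proof` ⟨23957⟩ by the union bound `STRIP ⊆ CORE ∪ (STRIP ∩ OFF-CORE)` (the bookkeeping of
`ToronSmallBall.assemblyDeep_proof`, with the window exponent divided by four). [cite: Luscher1983, §2] [cite: MontvayMunster1994, (3.145)] -/
theorem smallBall_window_of_landed :
    ∃ a : ℝ, 0 < a ∧ a ≤ 1 ∧ ∃ γ : ℝ, γ < 1 / 2 - 4 * a ∧
      ∃ β₀ : ℝ, ∃ L₀ : ℕ, ∀ β : ℝ, β₀ ≤ β → ∀ (L : ℕ) [NeZero L], L₀ ≤ L → (L : ℝ) ≤ β ^ a →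
        TT.insTrace L β (Set.indicator {U : GaugeConfig 3 L FemtoTransferGap.SU2 |
            |polDist U - polDist (configPerm (Equiv.swap (0 : Fin 3) 1) U)| ≤ β ^ (-γ)} fun _ => (1 : ℝ)) 0 ≤
          β ^ (-a) * TT.physTrace L β (2 * L) := by
  obtain ⟨γc, hγc, a₁, ha₁, β₁, L₁, h1⟩ := ToronSmallBall.toronCoreRaritySubQuartic_proof
  obtain ⟨a₀, ha₀, ha₀1, h2⟩ := ToronSmallBall.offCoreStripWindowDeep_proof γc hγc
  set a' : ℝ := min a₀ a₁ with ha'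
  have ha'0 : 0 < a' := lt_min ha₀ ha₁
  have ha'₀ : a' ≤ a₀ := min_le_left _ _
  have ha'₁ : a' ≤ a₁ := min_le_right _ _
  have ha'1 : a' ≤ 1 := ha'₀.trans ha₀1
  obtain ⟨γ, hγ, β₂, L₂, h2'⟩ := h2 a' ha'0 ha'₀
  refine ⟨a' / 4, by positivity, by linarith, γ, by linarith, max (max β₁ β₂) (max 1 ((2 : ℝ) ^ (4 / (3 * a')))), max L₁ L₂,
    fun β hβ L _ hL hLβ => ?_⟩
  have hββ₁ : β₁ ≤ β := ((le_max_left _ _).trans (le_max_left _ _)).trans hβ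
  have hββ₂ : β₂ ≤ β := ((le_max_right _ _).trans (le_max_left _ _)).trans hβ
  have hβ1 : 1 ≤ β := ((le_max_left _ _).trans (le_max_right _ _)).trans hβ
  have hβ2 : (2 : ℝ) ^ (4 / (3 * a')) ≤ β := ((le_max_right _ _).trans (le_max_right _ _)).trans hβ
  have hβ0 : 0 < β := by linarith
  have hL₁ : L₁ ≤ L := (le_max_left _ _).trans hL
  have hL₂ : L₂ ≤ L := (le_max_right _ _).trans hL
  have hL1 : 1 ≤ L := NeZero.one_le
  -- the windows nest
  have hLβ₁ : (L : ℝ) ≤ β ^ a₁ := hLβ.trans (Real.rpow_le_rpow_of_exponent_le hβ1 (by linarith))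
  have hLβ' : (L : ℝ) ≤ β ^ a' := hLβ.trans (Real.rpow_le_rpow_of_exponent_le hβ1 (by linarith))
  have hcore := h1 β hββ₁ L hL₁ hLβ₁
  have hoff := h2' β hββ₂ L hL₂ hLβ'
  set S := configPerm (G := FemtoTransferGap.SU2) (L := L) (Equiv.swap (0 : Fin 3) 1) with hS
  set Z : ℝ := TT.physTrace L β (2 * L) with hZ
  have hZpos : 0 < Z := TT.physTrace_two_mul_pos hL1 hβ1
  set CORE : Set (GaugeConfig 3 L FemtoTransferGap.SU2) := {U | polDist U ≤ β ^ (-γc)} with hCORE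
  set OFF : Set (GaugeConfig 3 L FemtoTransferGap.SU2) := {U | |polDist U - polDist (S U)| ≤ β ^ (-γ) ∧ β ^ (-γc) < polDist U} with hOFF
  set STRIP : Set (GaugeConfig 3 L FemtoTransferGap.SU2) := {U | |polDist U - polDist (S U)| ≤ β ^ (-γ)} with hSTRIP
  have hCOREm : MeasurableSet CORE := measurableSet_le isPhys_polDist.measurable measurable_const
  have hOFFm : MeasurableSet OFF :=
    (measurableSet_strip _).inter (measurableSet_lt measurable_const isPhys_polDist.measurable)
  have hSTRIPm : MeasurableSet STRIP := measurableSet_strip _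
  have hsub : STRIP ⊆ CORE ∪ OFF := fun U hU => by
    by_cases hc : polDist U ≤ β ^ (-γc)
    · exact Or.inl hc
    · exact Or.inr ⟨hU, not_le.1 hc⟩
  have hstrip : TT.insTrace L β (STRIP.indicator fun _ => (1 : ℝ)) 0 ≤ (β ^ (-a₁) + β ^ (-a')) * Z := by
    calc TT.insTrace L β (STRIP.indicator fun _ => (1 : ℝ)) 0 ≤ TT.insTrace L β ((CORE ∪ OFF).indicator fun _ => (1 : ℝ)) 0 :=
          TT.insTrace_indicator_zero_mono hβ0.le hSTRIPm (hCOREm.union hOFFm) hsub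
      _ ≤ TT.insTrace L β (CORE.indicator fun _ => (1 : ℝ)) 0 + TT.insTrace L β (OFF.indicator fun _ => (1 : ℝ)) 0 :=
          TT.insTrace_indicator_zero_union_le hβ0.le hCOREm hOFFm
      _ ≤ β ^ (-a₁) * Z + β ^ (-a') * Z := add_le_add hcore hoff
      _ = (β ^ (-a₁) + β ^ (-a')) * Z := by ring
  -- exponents: `β^{-a₁} + β^{-a'} ≤ 2β^{-a'} ≤ β^{-a'/4}` once `β^{3a'/4} ≥ 2`
  have hmono : β ^ (-a₁) ≤ β ^ (-a') := Real.rpow_le_rpow_of_exponent_le hβ1 (by linarith)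
  have h2le : (2 : ℝ) ≤ β ^ (3 * a' / 4) := by
    have h := Real.rpow_le_rpow (by positivity) hβ2 (by positivity : (0 : ℝ) ≤ 3 * a' / 4)
    rwa [← Real.rpow_mul (by norm_num), show 4 / (3 * a') * (3 * a' / 4) = 1 by field_simp, Real.rpow_one] at h
  have hkey : β ^ (-a₁) + β ^ (-a') ≤ β ^ (-(a' / 4)) := by
    have e1 : β ^ (-(a' / 4)) = β ^ (-a') * β ^ (3 * a' / 4) := by
      rw [← Real.rpow_add hβ0]; congr 1; ring
    have hpos : 0 ≤ β ^ (-a') := Real.rpow_nonneg hβ0.le _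
    calc β ^ (-a₁) + β ^ (-a') ≤ 2 * β ^ (-a') := by linarith
      _ = β ^ (-a') * 2 := mul_comm _ _
      _ ≤ β ^ (-a') * β ^ (3 * a' / 4) := mul_le_mul_of_nonneg_left h2le hpos
      _ = β ^ (-(a' / 4)) := e1.symm
  calc TT.insTrace L β (STRIP.indicator fun _ => (1 : ℝ)) 0 ≤ (β ^ (-a₁) + β ^ (-a')) * Z := hstrip
    _ ≤ β ^ (-(a' / 4)) * Z := mul_le_mul_of_nonneg_right hkey hZpos.le

/-! ## §3 ★★ The twist-ratio window -/

/-- ★★ **THE TWIST-RATIO WINDOW.**  There are `a > 0`, `β₀`, `L₀` such that for all `β ≥ β₀` and `L₀ ≤ L ≤ β^a`: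
`0 ≤ Z^S_phys(L, β, 2L) ≤ β^{−a} · Z_phys(L, β, 2L)` — on the Laplace window the swap-twisted zero-flux partition function of the `2L × L³` torus is a
polynomially small fraction of the periodic one, UNIFORMLY in `L` (twist free energy `≥ a log β`).  Unconditional: §1 fed with §2, and the exponent
halved once more to absorb the constant.  Strictly stronger than `TwistDeficitLaplaceWindow` ⟨23776⟩. [cite: tHooft1979Flux] [cite: TomboulisYaffe1985]
[cite: Luscher1983, §2] -/
theorem twistRatio_window :
    ∃ a : ℝ, 0 < a ∧ ∃ β₀ : ℝ, ∃ L₀ : ℕ, ∀ β : ℝ, β₀ ≤ β → ∀ (L : ℕ) [NeZero L], L₀ ≤ L → (L : ℝ) ≤ β ^ a →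
      0 ≤ TT.twistTrace L β (2 * L) ∧ TT.twistTrace L β (2 * L) ≤ β ^ (-a) * TT.physTrace L β (2 * L) := by
  obtain ⟨a, ha, ha1, γ, hγ, hSB⟩ := smallBall_window_of_landed
  obtain ⟨β₀, L₀, hW⟩ := twistRatio_window_of_smallBall ha ha1 hγ hSB
  refine ⟨a / 2, by positivity, max (max β₀ 1) ((2 : ℝ) ^ (2 / a)), max L₀ 1, fun β hβ L _ hL hLβ => ?_⟩
  have hββ₀ : β₀ ≤ β := ((le_max_left _ _).trans (le_max_left _ _)).trans hβ
  have hβ1 : 1 ≤ β := ((le_max_right _ _).trans (le_max_left _ _)).trans hβ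
  have hβ2 : (2 : ℝ) ^ (2 / a) ≤ β := (le_max_right _ _).trans hβ
  have hβ0 : 0 < β := by linarith
  have hL₀ : L₀ ≤ L := (le_max_left _ _).trans hL
  have hL1 : 1 ≤ L := (le_max_right _ _).trans hL
  have hLβa : (L : ℝ) ≤ β ^ a := hLβ.trans (Real.rpow_le_rpow_of_exponent_le hβ1 (by linarith))
  have hZpos : 0 < TT.physTrace L β (2 * L) := TT.physTrace_two_mul_pos hL1 hβ1
  have hmain := hW β hββ₀ L hL₀ hLβa
  have h2le : (2 : ℝ) ≤ β ^ (a / 2) := by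
    have h := Real.rpow_le_rpow (by positivity) hβ2 (by positivity : (0 : ℝ) ≤ a / 2)
    rwa [← Real.rpow_mul (by norm_num), show 2 / a * (a / 2) = 1 by field_simp, Real.rpow_one] at h
  have hkey : 2 * β ^ (-a) ≤ β ^ (-(a / 2)) := by
    have e1 : β ^ (-(a / 2)) = β ^ (-a) * β ^ (a / 2) := by
      rw [← Real.rpow_add hβ0]; congr 1; ring
    have hpos : 0 ≤ β ^ (-a) := Real.rpow_nonneg hβ0.le _
    calc 2 * β ^ (-a) = β ^ (-a) * 2 := mul_comm _ _
      _ ≤ β ^ (-a) * β ^ (a / 2) := mul_le_mul_of_nonneg_left h2le hpos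
      _ = β ^ (-(a / 2)) := e1.symm
  refine ⟨TT.twistTrace_two_mul_nonneg β, hmain.trans ?_⟩
  exact mul_le_mul_of_nonneg_right hkey hZpos.le

/-- On the window the twist deficit is almost total: `(1 − β^{−a})·Z_phys(2L) ≤ Z_phys(2L) − Z^S_phys(2L)` (compare `TwistDeficitLaplaceWindow`
⟨23776⟩, which asks only `β^{−k}·Z ≤ Z − Z^S`). [cite: tHooft1979Flux] -/
theorem twistDeficit_window_almost_total :
    ∃ a : ℝ, 0 < a ∧ ∃ β₀ : ℝ, ∃ L₀ : ℕ, ∀ β : ℝ, β₀ ≤ β → ∀ (L : ℕ) [NeZero L], L₀ ≤ L → (L : ℝ) ≤ β ^ a →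
      (1 - β ^ (-a)) * TT.physTrace L β (2 * L) ≤ TT.physTrace L β (2 * L) - TT.twistTrace L β (2 * L) := by
  obtain ⟨a, ha, β₀, L₀, h⟩ := twistRatio_window
  refine ⟨a, ha, β₀, L₀, fun β hβ L _ hL hLβ => ?_⟩
  have h2 := (h β hβ L hL hLβ).2
  linarith

/-! ## §4 ★ O1 eventually in `L` -/

/-- ★ **O1 (`TwistRatioVanishesFixedL`, item stmt-QuantumFields-23802) for every `L` above the window threshold**: there is `L₀` such that for
every fixed `L ≥ L₀` the swap expectation `⟨S⟩_β = Z^S_phys(L, β, 2L)/Z_phys(L, β, 2L) → 0` as `β → ∞` (indeed `≤ β^{−a}` eventually).  The item asks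
this for every `L ≥ 2`; the threshold `L₀` here is the (existential) one of the landed toron-core cruxes ⟨23956⟩∕⟨23957⟩. [cite: tHooft1979Flux]
[cite: Luscher1983, §2] -/
theorem twistRatio_tendsto_zero_eventually :
    ∃ L₀ : ℕ, ∀ (L : ℕ) [NeZero L], L₀ ≤ L →
      Filter.Tendsto (fun β : ℝ => TT.twistTrace L β (2 * L) / TT.physTrace L β (2 * L)) Filter.atTop (nhds 0) := by
  obtain ⟨a, ha, β₀, L₀, h⟩ := twistRatio_window
  refine ⟨max L₀ 1, fun L _ hL => ?_⟩
  have hL₀ : L₀ ≤ L := (le_max_left _ _).trans hL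
  have hL1 : 1 ≤ L := (le_max_right _ _).trans hL
  have hL0 : (0 : ℝ) < L := by exact_mod_cast (show 0 < L by omega)
  -- eventually `β ≥ β₀`, `β ≥ 1` and `L ≤ β^a`
  have hev : ∀ᶠ β : ℝ in atTop, 0 ≤ TT.twistTrace L β (2 * L) / TT.physTrace L β (2 * L) ∧
      TT.twistTrace L β (2 * L) / TT.physTrace L β (2 * L) ≤ β ^ (-a) := by
    filter_upwards [eventually_ge_atTop β₀, eventually_ge_atTop (1 : ℝ), eventually_ge_atTop ((L : ℝ) ^ (1 / a))] with β hβ hβ1 hβL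
    have hβ0 : 0 < β := by linarith
    have hLβ : (L : ℝ) ≤ β ^ a := by
      have h1 := Real.rpow_le_rpow (Real.rpow_nonneg hL0.le _) hβL ha.le
      rwa [← Real.rpow_mul hL0.le, show 1 / a * a = 1 by field_simp, Real.rpow_one] at h1
    have hZpos : 0 < TT.physTrace L β (2 * L) := TT.physTrace_two_mul_pos hL1 hβ1
    obtain ⟨h0, h1⟩ := h β hβ L hL₀ hLβ
    exact ⟨div_nonneg h0 hZpos.le, (div_le_iff₀ hZpos).2 h1⟩
  refine tendsto_of_tendsto_of_tendsto_of_le_of_le' tendsto_const_nhds (tendsto_rpow_neg_atTop ha) ?_ ?_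
  · exact hev.mono fun β hβ => hβ.1
  · exact hev.mono fun β hβ => hβ.2

end Summit.QuantumFields.YangMills.Theorems.SwapTwistDeficit

end
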